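import Mathlib
import HarnessLib
import Summits.Ventures.LatticeQCDFlow.Exactness.ExogenousAdaptationExact
import Summits.Ventures.LatticeQCDFlow.Exactness.SelfTunedFlowChoiceBias

/-!
# LatticeQCDFlow / Exactness — LEARNING ON THE JOB, VI: TWO BOUNDS ON THE ONE-STEP BIAS OF AN ADAPTIVE SAMPLER — by the DEPENDENCE between
# the parameters in use and the configuration, and by the SIZE of the adaptation

HONEST FRAMING: exact (Metropolis-corrected) sampling algorithms for lattice gauge theory;
figures of merit are autocorrelation/cost numbers at stated couplings and volumes; no
continuum-physics claim.

Venture `LatticeQCDFlow` (cell pub-lqcd), topic `Exactness`, FANOUT row 30 (lean-1 GEN-44, theme LEARNING ON THE JOB).  NEW WORK of the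
cell; no definition is introduced, nothing is cited as a fact.  Tree inputs: `ExogenousAdaptationExact` (`exogenous_prod_bind_eq`: a product
law of (parameters, configuration) gives an exact step), `SelfTunedFlowChoiceBias` (`lintegral_apply_eq_of_invariant`).  Between the two extremes of the chapter — parameters independent of the
configuration (exact, `ExogenousAdaptationExact`) and parameters a function of it (biased, `SelfTunedFlowChoiceBias`) — the bias is
controlled by how far the joint law is from a product, and, independently, by how far apart the kernels among which the adaptation switches
are.  Printed counterparts NAMED ONLY: the Diminishing-Adaptation condition of adaptive MCMC (Roberts–Rosenthal 2007, in one-step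
quantitative form), β-mixing ∕ absolute-regularity coefficients.

## Setting
A probability target `π` on `Ω`; an adapted update `κ : Kernel (H × Ω) Ω` (Markov) every frozen section of which is exact for `π`; the
joint law `ρ` (a probability on `H × Ω`) of the parameters in use and the current configuration — ANY dependence; the next configuration
has law `ρκ := ρ.bind κ`.

## Results (no `sorry`)
* §1 BIAS ≤ DEPENDENCE.  Hypothesis: `ρ ≥ (1 − β)·(ρ_H ⊗ π)` for some probability `ρ_H` on parameters and `β ≤ 1` — the joint law
  dominates a `(1 − β)`-fraction of a product (a β-mixing-type coefficient of dependence between parameters and configuration; `β = 0` iff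
  `ρ` IS that product).  Then **`adaptBias_lower_of_dominated`** `(1 − β)π(B) ≤ ρκ(B)`, **`adaptBias_upper_of_dominated`**
  `ρκ(B) ≤ π(B) + β`, **`adaptBias_real_abs_le_of_dominated`** `|ρκ(B) − π(B)| ≤ β` for every measurable `B`.  (The lag-`n` bound
  `(1 − ε)ⁿ` of `LaggedAdaptationDoeblin` is the Doeblin estimate of this coefficient for parameters computed `n` updates ago.)
* §2 BIAS ≤ SIZE OF THE ADAPTATION.  Hypothesis: the configuration's marginal is `π` (`ρ(H × B) = π(B)`) and every section is setwise
  within `Δ` of ONE exact Markov kernel `P` (`κ(h, x)(B) ≤ P(x, B) + Δ`, `P(x, B) ≤ κ(h, x)(B) + Δ`).  Then **`adaptBias_upper_of_close`**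
  `ρκ(B) ≤ π(B) + Δ`, **`adaptBias_lower_of_close`** `π(B) ≤ ρκ(B) + Δ`, **`adaptBias_real_abs_le_of_close`** `|ρκ(B) − π(B)| ≤ Δ` —
  however strong the dependence: an adaptation that can only move the kernel a little can only bias a little (Diminishing Adaptation,
  one step, quantified).
* §3 `adaptBias_eq_of_product` — sanity: `β = 0` (a product) gives `ρκ = π` back (`ExogenousAdaptationExact`).
-/

namespace Summit.Ventures.LatticeQCDFlow.Exactness

open MeasureTheory ProbabilityTheory
open scoped ENNReal

variable {Ω H : Type*} [MeasurableSpace Ω] [MeasurableSpace H] {π : Measure Ω} [IsProbabilityMeasure π]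

/-! ## §1 Bias ≤ dependence -/

/-- **LOWER BOUND FROM DOMINATION**: `ρ ≥ (1 − β)(ρ_H ⊗ π)` ⇒ `(1 − β)π(B) ≤ ρκ(B)`. [ours] -/
theorem adaptBias_lower_of_dominated (κ : Kernel (H × Ω) Ω)
    (hκ : ∀ (h : H) {B : Set Ω}, MeasurableSet B → ∫⁻ x, κ (h, x) B ∂π = π B) (ρ : Measure (H × Ω)) (ρH : Measure H)
    [IsProbabilityMeasure ρH] {β : ℝ≥0∞} (hdom : (1 - β) • (ρH.prod π) ≤ ρ) {B : Set Ω} (hB : MeasurableSet B) :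
    (1 - β) * π B ≤ (ρ.bind κ) B := by
  have hprod : ((ρH.prod π).bind κ) B = π B := by rw [exogenous_prod_bind_eq κ hκ ρH]
  calc (1 - β) * π B = (1 - β) * ((ρH.prod π).bind κ) B := by rw [hprod]
    _ = ∫⁻ p, κ p B ∂((1 - β) • (ρH.prod π)) := by
      rw [Measure.bind_apply hB (Kernel.aemeasurable _), lintegral_smul_measure, smul_eq_mul]
    _ ≤ ∫⁻ p, κ p B ∂ρ := lintegral_mono' hdom le_rfl
    _ = (ρ.bind κ) B := by rw [Measure.bind_apply hB (Kernel.aemeasurable _)]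

/-- **UPPER BOUND FROM DOMINATION**: `ρ ≥ (1 − β)(ρ_H ⊗ π)`, `ρ` a probability ⇒ `ρκ(B) ≤ π(B) + β`. [ours] -/
theorem adaptBias_upper_of_dominated (κ : Kernel (H × Ω) Ω) [IsMarkovKernel κ]
    (hκ : ∀ (h : H) {B : Set Ω}, MeasurableSet B → ∫⁻ x, κ (h, x) B ∂π = π B) (ρ : Measure (H × Ω)) [IsProbabilityMeasure ρ]
    (ρH : Measure H) [IsProbabilityMeasure ρH] {β : ℝ≥0∞} (hβ : β ≤ 1) (hdom : (1 - β) • (ρH.prod π) ≤ ρ) {B : Set Ω}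
    (hB : MeasurableSet B) : (ρ.bind κ) B ≤ π B + β := by
  haveI : IsProbabilityMeasure (ρ.bind κ) := ⟨by rw [Measure.bind_apply MeasurableSet.univ (Kernel.aemeasurable _)]; simp⟩
  have hc := adaptBias_lower_of_dominated κ hκ ρ ρH hdom hB.compl
  -- `ρκ(B) + (1 − β)π(Bᶜ) ≤ ρκ(B) + ρκ(Bᶜ) = 1 = π(B) + (1 − β)π(Bᶜ) + βπ(Bᶜ) ≤ π(B) + (1 − β)π(Bᶜ) + β`
  have hfin : (1 - β) * π Bᶜ ≠ ⊤ := ENNReal.mul_ne_top (ne_top_of_le_ne_top ENNReal.one_ne_top tsub_le_self) (measure_ne_top _ _)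
  have h1 : (ρ.bind κ) B + (1 - β) * π Bᶜ ≤ π B + β + (1 - β) * π Bᶜ :=
    calc (ρ.bind κ) B + (1 - β) * π Bᶜ ≤ (ρ.bind κ) B + (ρ.bind κ) Bᶜ := add_le_add le_rfl hc
      _ = 1 := by rw [measure_add_measure_compl hB, measure_univ]
      _ = π B + π Bᶜ := by rw [measure_add_measure_compl hB, measure_univ]
      _ = π B + (β + (1 - β)) * π Bᶜ := by rw [add_tsub_cancel_of_le hβ, one_mul]
      _ = π B + β * π Bᶜ + (1 - β) * π Bᶜ := by rw [add_mul, add_assoc]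
      _ ≤ π B + β * 1 + (1 - β) * π Bᶜ := by gcongr; exact prob_le_one
      _ = π B + β + (1 - β) * π Bᶜ := by rw [mul_one]
  exact (ENNReal.add_le_add_iff_right hfin).1 h1

/-- **BIAS ≤ DEPENDENCE**: `|ρκ(B) − π(B)| ≤ β` whenever the joint law of (parameters, configuration) dominates `(1 − β)` times a product
`ρ_H ⊗ π`. [ours] -/
theorem adaptBias_real_abs_le_of_dominated (κ : Kernel (H × Ω) Ω) [IsMarkovKernel κ]
    (hκ : ∀ (h : H) {B : Set Ω}, MeasurableSet B → ∫⁻ x, κ (h, x) B ∂π = π B) (ρ : Measure (H × Ω)) [IsProbabilityMeasure ρ]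
    (ρH : Measure H) [IsProbabilityMeasure ρH] {β : ℝ≥0∞} (hβ : β ≤ 1) (hdom : (1 - β) • (ρH.prod π) ≤ ρ) {B : Set Ω}
    (hB : MeasurableSet B) : |(ρ.bind κ).real B - π.real B| ≤ β.toReal := by
  haveI : IsProbabilityMeasure (ρ.bind κ) := ⟨by rw [Measure.bind_apply MeasurableSet.univ (Kernel.aemeasurable _)]; simp⟩
  have hβt : β ≠ ⊤ := ne_top_of_le_ne_top ENNReal.one_ne_top hβ
  have hup : (ρ.bind κ).real B ≤ π.real B + β.toReal := by
    have h := adaptBias_upper_of_dominated κ hκ ρ ρH hβ hdom hB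
    have h' := ENNReal.toReal_mono (ENNReal.add_ne_top.2 ⟨measure_ne_top _ _, hβt⟩) h
    rwa [ENNReal.toReal_add (measure_ne_top _ _) hβt] at h'
  have hlo : (1 - β.toReal) * π.real B ≤ (ρ.bind κ).real B := by
    have h := adaptBias_lower_of_dominated κ hκ ρ ρH hdom hB
    have h' := ENNReal.toReal_mono (measure_ne_top _ _) h
    rwa [ENNReal.toReal_mul, ENNReal.toReal_sub_of_le hβ ENNReal.one_ne_top, ENNReal.toReal_one] at h'
  have hπ1 := measureReal_le_one (μ := π) (s := B)
  have hβ0 : 0 ≤ β.toReal := ENNReal.toReal_nonneg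
  rw [abs_le]
  constructor <;> nlinarith

/-! ## §2 Bias ≤ size of the adaptation -/

omit [IsProbabilityMeasure π] in
/-- The configuration-marginal hypothesis in integrated form: `∫ g(x) ρ(dh, dx) = ∫ g dπ`. [ours, bookkeeping] -/
theorem lintegral_snd_eq_of_marginal (ρ : Measure (H × Ω)) (hmarg : ρ.map Prod.snd = π) {g : Ω → ℝ≥0∞} (hg : Measurable g) :
    ∫⁻ p, g p.2 ∂ρ = ∫⁻ x, g x ∂π := by
  rw [← hmarg, lintegral_map hg measurable_snd]

omit [IsProbabilityMeasure π] in
/-- **UPPER BOUND FROM CLOSENESS**: if the configuration's marginal is `π` and every section is setwise within `Δ` above an exact Markov `P`,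
then `ρκ(B) ≤ π(B) + Δ`. [ours] -/
theorem adaptBias_upper_of_close (κ : Kernel (H × Ω) Ω) (P : Kernel Ω Ω) (hP : Kernel.Invariant P π) (ρ : Measure (H × Ω))
    [IsProbabilityMeasure ρ] (hmarg : ρ.map Prod.snd = π) {Δ : ℝ≥0∞} {B : Set Ω} (hB : MeasurableSet B)
    (hclose : ∀ (h : H) (x : Ω), κ (h, x) B ≤ P x B + Δ) : (ρ.bind κ) B ≤ π B + Δ := by
  rw [Measure.bind_apply hB (Kernel.aemeasurable _)]
  calc ∫⁻ p, κ p B ∂ρ ≤ ∫⁻ p, P p.2 B + Δ ∂ρ := lintegral_mono fun p => by obtain ⟨h, x⟩ := p; exact hclose h x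
    _ = ∫⁻ p, P p.2 B ∂ρ + Δ := by rw [lintegral_add_right _ measurable_const, lintegral_const, measure_univ, mul_one]
    _ = ∫⁻ x, P x B ∂π + Δ := by rw [lintegral_snd_eq_of_marginal ρ hmarg (Kernel.measurable_coe P hB)]
    _ = π B + Δ := by rw [lintegral_apply_eq_of_invariant P hP hB]

omit [IsProbabilityMeasure π] in
/-- **LOWER BOUND FROM CLOSENESS**: symmetrically `π(B) ≤ ρκ(B) + Δ`. [ours] -/
theorem adaptBias_lower_of_close (κ : Kernel (H × Ω) Ω) (P : Kernel Ω Ω) (hP : Kernel.Invariant P π) (ρ : Measure (H × Ω))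
    [IsProbabilityMeasure ρ] (hmarg : ρ.map Prod.snd = π) {Δ : ℝ≥0∞} {B : Set Ω} (hB : MeasurableSet B)
    (hclose : ∀ (h : H) (x : Ω), P x B ≤ κ (h, x) B + Δ) : π B ≤ (ρ.bind κ) B + Δ := by
  rw [Measure.bind_apply hB (Kernel.aemeasurable _), ← lintegral_apply_eq_of_invariant P hP hB,
    ← lintegral_snd_eq_of_marginal ρ hmarg (Kernel.measurable_coe P hB)]
  calc ∫⁻ p, P p.2 B ∂ρ ≤ ∫⁻ p, κ p B + Δ ∂ρ := lintegral_mono fun p => by obtain ⟨h, x⟩ := p; exact hclose h x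
    _ = ∫⁻ p, κ p B ∂ρ + Δ := by
      rw [lintegral_add_right _ measurable_const, lintegral_const, measure_univ, mul_one]

/-- **BIAS ≤ SIZE OF THE ADAPTATION**: if every kernel the adaptation can use is setwise within `Δ` of one exact kernel and the
configuration is currently `π`-distributed (whatever its dependence on the parameters), then `|ρκ(B) − π(B)| ≤ Δ`. [ours] -/
theorem adaptBias_real_abs_le_of_close (κ : Kernel (H × Ω) Ω) [IsMarkovKernel κ] (P : Kernel Ω Ω) (hP : Kernel.Invariant P π)
    (ρ : Measure (H × Ω)) [IsProbabilityMeasure ρ] (hmarg : ρ.map Prod.snd = π) {Δ : ℝ≥0∞} (hΔ : Δ ≠ ⊤) {B : Set Ω}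
    (hB : MeasurableSet B) (habove : ∀ (h : H) (x : Ω), κ (h, x) B ≤ P x B + Δ)
    (hbelow : ∀ (h : H) (x : Ω), P x B ≤ κ (h, x) B + Δ) : |(ρ.bind κ).real B - π.real B| ≤ Δ.toReal := by
  haveI : IsProbabilityMeasure (ρ.bind κ) := ⟨by rw [Measure.bind_apply MeasurableSet.univ (Kernel.aemeasurable _)]; simp⟩
  have hup : (ρ.bind κ).real B ≤ π.real B + Δ.toReal := by
    have h' := ENNReal.toReal_mono (ENNReal.add_ne_top.2 ⟨measure_ne_top _ _, hΔ⟩) (adaptBias_upper_of_close κ P hP ρ hmarg hB habove)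
    rwa [ENNReal.toReal_add (measure_ne_top _ _) hΔ] at h'
  have hlo : π.real B ≤ (ρ.bind κ).real B + Δ.toReal := by
    have h' := ENNReal.toReal_mono (ENNReal.add_ne_top.2 ⟨measure_ne_top _ _, hΔ⟩) (adaptBias_lower_of_close κ P hP ρ hmarg hB hbelow)
    rwa [ENNReal.toReal_add (measure_ne_top _ _) hΔ] at h'
  rw [abs_le]; constructor <;> linarith

/-! ## §3 Sanity: no dependence, no bias -/

/-- `β = 0`: a product law gives the exact step back. [ours, remark] -/
theorem adaptBias_eq_of_product (κ : Kernel (H × Ω) Ω)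
    (hκ : ∀ (h : H) {B : Set Ω}, MeasurableSet B → ∫⁻ x, κ (h, x) B ∂π = π B) (ρH : Measure H) [IsProbabilityMeasure ρH]
    (B : Set Ω) : ((ρH.prod π).bind κ) B = π B := by
  rw [exogenous_prod_bind_eq κ hκ ρH]

end Summit.Ventures.LatticeQCDFlow.Exactness
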